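import Literature.AlgebraicGeometry.AbelianSchemes.DualPairDimEq
import Literature.AlgebraicGeometry.AbelianSchemes.DualPairHatRelDimTransport
import HarnessLib

/-!
# `dim Â_s = dim A_s` at EVERY field-valued point of ANY base, for EVERY dual pair — unconditionally
# (Mumford AV §13 Cor. 3 at the fibres; the binder `hdim` of the Θ-spread ∕ W-line ∕ (s2-D) letters discharged by name)

Layer `Literature/AlgebraicGeometry/AbelianSchemes`, namespace `Literature.AlgebraicGeometry.AbelianSchemes.AbelianSchemeOver`.
THEOREMS ONLY (no definition, no named fact, no instance, no notation, no `sorry`).  Cell `hodgecm-mathlib` (D-0151), P6 «MOD programme»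
(prover seat B-p02 (g22), capital after (σ1-g) ★).

B-p08 (g33)'s ★ (σ1-g) `DualPair.dim_hat_eq` proves `dim Â = dim A` for every dual pair of an abelian VARIETY over any field
([MumfordAV1970] §13 Cor. 3).  This file moves it to the fibres of an abelian SCHEME `A → S` with a dual pair `D = (Â, 𝒫)`
([MilneAV2008] I §8): base-change the dual pair to the point (★ `DualPair.baseChange s`, whose dual is `Â ×_S Spec K = Â_s` on the nose) and
read ★ `dim_hat_eq` there — the abelian scheme `A ×_S Spec K` over `Spec K` IS `ofAbelianVariety` of its own `toAffine.toAbelianVariety`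
(structure eta), so no transport is needed.  Every previously CONDITIONAL form — ★ `DualPair.dim_hat_fibre_eq_of_isOfRelDim` (two
relative-dimension clauses), ★ `DualPair.dim_hat_fibre_eq_of_dualAbelianSchemeExists` (the P-2′ «DUAL-S» letter), ★
`Polarization.dim_hat_fibre_eq` (a polarization, characteristic `0`) — is now free of its hypothesis:

* §1 **`DualPair.dim_toAffine_toAbelianVariety_eq_dim_hat`** — over a field `K`, ANY `A → Spec K` and ANY dual pair:
  `dim A = dim Â` (`toAffine.toAbelianVariety` currency);
* §2 **`DualPair.dim_fibre_eq_dim_hat_fibre`** — ANY base `S`, ANY dual pair, ANY field point `s : Spec K → S`: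
  `dim A_s = dim Â_s` — THE `hdim` BINDER of ★ `IsLambdaOfAtRootOfSquareAtPoint` §3 ∕ §4 ∕ §5 (`exists_isAmple_isLambdaOfAt_of_isLambdaOfAt_sq…
  hsq hamp₂ (DualPair.dim_fibre_eq_dim_hat_fibre D s)`), of ★ `IsLambdaOfAt.exists_comp_sq_eq_of_isAmple`, ★
  `IsLambdaOfAt.exists_comp_eq_of_isAmple_of_dim_eq`, VERBATIM; **`DualPair.hat_fibre_dim_eq`** — the same in the orientation `dim Â_s = dim A_s`
  of ★ `DualPairHatRelDimTransport` ∕ ★ `DualPairHatRelDimOfDualExists`;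
* §3 **`DualPair.hat_baseChange_baseChange_dim_eq`**, **`DualPair.hat_baseChange_dim_eq`** — the W-line ∕ (s2-D) packagings (★
  `DualPair.dim_hat_baseChange_baseChange_eq`, ★ `DualPair.dim_hat_baseChange_eq`) with their fibre hypothesis discharged;
  **`DualPair.forall_dim_hat_fibre_eq`** — the `∀ Ω s` clause of ★ `exists_dualPair_forall_dim_hat_fibre_eq` for EVERY dual pair.

HC_CM is proved only modulo the printed citations (2 remaining named inputs hLiu418, h413) until rung 0 closes; this file asserts nothing about HC
and is count-neutral ★ capital.

## References
* [MumfordAV1970] D. Mumford, *Abelian Varieties* (1970), §13 Cor. 3 (p. 130).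
* [MilneAV2008] J. S. Milne, *Abelian Varieties* (v2.0, 2008), I §8 pp. 36–37 (Rem. 8.8: `dim A^∨ = dim A`).
* [GortzWedhorn2023] U. Görtz, T. Wedhorn, *Algebraic Geometry II* (2023), Thm. 27.198 (2) (pp. 679–680), Remark 27.218 (1) (p. 689).
* [MumfordFogartyKirwan1994] D. Mumford, J. Fogarty, F. Kirwan, *GIT*, 3rd ed. (1994), Ch. 6 §1 Cor. 6.8 (p. 118).
-/

set_option autoImplicit false

noncomputable section

-- `TopCat.Presheaf`/`Scheme.Modules` and the `Over`/`Scheme` wrappers are not reducible (as in ★ `DualPairDimEq`).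
set_option backward.isDefEq.respectTransparency false

universe u

open CategoryTheory CategoryTheory.Limits AlgebraicGeometry

namespace Literature.AlgebraicGeometry.AbelianSchemes

namespace AbelianSchemeOver

open Literature.AlgebraicGeometry.Motives

/-! ## §1 Over a field: `dim A = dim Â` for every dual pair of every `A → Spec K` -/

section OverField

variable {K : Type u} [Field K] {A : AbelianSchemeOver (Spec (.of K))} (D : A.DualPair)

/-- **`dim A = dim Â` over a field, for EVERY abelian scheme `A → Spec K` and EVERY dual pair** ([MumfordAV1970] §13 Cor. 3; [MilneAV2008] I §8
Rem. 8.8): ★ `DualPair.dim_hat_eq` (B-p08 (g33), (σ1-g)) read on `A = ofAbelianVariety (A.toAffine.toAbelianVariety)` (structure eta — the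
same record), in the `toAffine.toAbelianVariety` currency of ★ `DualPairHatRelDimTransport`. [cite: MumfordAV1970, §13 Cor. 3 (p. 130)]
[cite: MilneAV2008, I §8 pp. 36–37] -/
theorem DualPair.dim_toAffine_toAbelianVariety_eq_dim_hat :
    A.toAffine.toAbelianVariety.dim = D.hat.toAffine.toAbelianVariety.dim :=
  (DualPair.dim_hat_eq A.toAffine.toAbelianVariety D).symm

/-- Over a field, the relative dimension of the dual: `Â → Spec K` has relative dimension `dim A` (★ `isOfRelDim_dim_toAffine` for `Â`, §1).
[cite: MumfordAV1970, §13 Cor. 3 (p. 130)] [cite: GortzWedhorn2020, Remark 16.54 (p. 539)] -/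
theorem DualPair.isOfRelDim_hat_dim_toAffine : D.hat.IsOfRelDim A.toAffine.toAbelianVariety.dim := by
  rw [DualPair.dim_toAffine_toAbelianVariety_eq_dim_hat D]
  exact isOfRelDim_dim_toAffine D.hat

end OverField

/-! ## §2 Any base: `dim A_s = dim Â_s` at every field-valued point -/

section AnyBase

variable {S : Scheme.{u}} {A : AbelianSchemeOver S} (D : A.DualPair)

/-- **`dim A_s = dim Â_s` AT EVERY FIELD-VALUED POINT `s : Spec K → S`, FOR EVERY DUAL PAIR OF EVERY ABELIAN SCHEME** — no relative-dimension,
polarization, connectedness, characteristic or dual-existence hypothesis ([MumfordAV1970] §13 Cor. 3 at the fibre): §1 for the base-changed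
dual pair ★ `D.baseChange s` over `Spec K`, whose dual is `Â ×_S Spec K = Â_s` definitionally (★ `DualPair.baseChange_hat`).  THE `hdim` BINDER
of ★ `IsLambdaOfAtRootOfSquareAtPoint` §3–§5 and of ★ `IsLambdaOfAt.exists_comp_sq_eq_of_isAmple`, verbatim. [cite: MumfordAV1970, §13 Cor. 3 (p. 130)]
[cite: MilneAV2008, I §8 pp. 36–37] [cite: GortzWedhorn2023, Remark 27.218 (1) (p. 689)] -/
theorem DualPair.dim_fibre_eq_dim_hat_fibre {K : Type u} [Field K] (s : Spec (.of K) ⟶ S) :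
    (A.fibre s).toAbelianVariety.dim = (D.hat.fibre s).toAbelianVariety.dim :=
  DualPair.dim_toAffine_toAbelianVariety_eq_dim_hat (D.baseChange s)

/-- **`dim Â_s = dim A_s`** at every field-valued point, every dual pair (§2 in the orientation of ★ `DualPair.dim_hat_fibre_eq_of_isOfRelDim` ∕
★ `DualPair.dim_hat_fibre_eq_of_dualAbelianSchemeExists`, whose hypotheses it discharges). [cite: MumfordAV1970, §13 Cor. 3 (p. 130)]
[cite: GortzWedhorn2023, Thm. 27.198 (2) (pp. 679–680)] -/
theorem DualPair.hat_fibre_dim_eq {K : Type u} [Field K] (s : Spec (.of K) ⟶ S) :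
    (D.hat.fibre s).toAbelianVariety.dim = (A.fibre s).toAbelianVariety.dim :=
  (DualPair.dim_fibre_eq_dim_hat_fibre D s).symm

/-- The relative dimension of the dual AT A POINT: `Â_s = Â ×_S Spec K → Spec K` has relative dimension `dim A_s` (§1 for ★ `D.baseChange s`).
[cite: MumfordAV1970, §13 Cor. 3 (p. 130)] [cite: GortzWedhorn2020, Remark 16.54 (p. 539)] -/
theorem DualPair.isOfRelDim_hat_baseChange_dim_fibre {K : Type u} [Field K] (s : Spec (.of K) ⟶ S) :
    (D.hat.baseChange s).IsOfRelDim (A.fibre s).toAbelianVariety.dim :=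
  DualPair.isOfRelDim_hat_dim_toAffine (D.baseChange s)

/-! ## §3 The packaged forms of the W-line ∕ (s2-D) glue, hypotheses discharged -/

/-- **The W-line's literal `hdim`, unconditionally**: for every dual pair `D` of `A → S`, every `f : T → S` and every field point `x` of `T`,
`dim` of the dual in the ITERATED base change `(D ×_S T) ×_T Spec k` equals `dim ((A ×_S T) ×_T Spec k)` in the `toAffine.toAbelianVariety`
currency (★ `DualPair.dim_hat_baseChange_baseChange_eq` fed with §2 at `x ≫ f`). [cite: MumfordAV1970, §13 Cor. 3 (p. 130)]
[cite: MumfordFogartyKirwan1994, Ch. 6 §1 Cor. 6.8 (p. 118)] -/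
theorem DualPair.hat_baseChange_baseChange_dim_eq {T : Scheme.{u}} (f : T ⟶ S) {k : Type u} [Field k] (x : Spec (.of k) ⟶ T) :
    ((D.baseChange f).baseChange x).hat.toAffine.toAbelianVariety.dim =
      ((A.baseChange f).baseChange x).toAffine.toAbelianVariety.dim :=
  D.dim_hat_baseChange_baseChange_eq f x (DualPair.hat_fibre_dim_eq D (x ≫ f))

/-- One base change deep, unconditionally: `dim (D.baseChange x).hat = dim (A.baseChange x)` (`toAffine.toAbelianVariety` currency), every
dual pair, every field point (★ `DualPair.dim_hat_baseChange_eq` fed with §2). [cite: MumfordAV1970, §13 Cor. 3 (p. 130)] -/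
theorem DualPair.hat_baseChange_dim_eq {k : Type u} [Field k] (x : Spec (.of k) ⟶ S) :
    (D.baseChange x).hat.toAffine.toAbelianVariety.dim = (A.baseChange x).toAffine.toAbelianVariety.dim :=
  D.dim_hat_baseChange_eq x (DualPair.hat_fibre_dim_eq D x)

/-- The `∀ Ω s` clause of ★ `exists_dualPair_forall_dim_hat_fibre_eq`, for EVERY dual pair and without the P-2′ letter (consumers that take
the dual pair as a binder together with `hdim` at all field points). [cite: MumfordAV1970, §13 Cor. 3 (p. 130)]
[cite: GortzWedhorn2023, Thm. 27.198 (2) (pp. 679–680)] -/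
theorem DualPair.forall_dim_hat_fibre_eq :
    ∀ (Ω : Type u) [Field Ω] (s : Spec (.of Ω) ⟶ S), (D.hat.fibre s).toAbelianVariety.dim = (A.fibre s).toAbelianVariety.dim :=
  fun _ _ s => DualPair.hat_fibre_dim_eq D s

end AnyBase

end AbelianSchemeOver

end Literature.AlgebraicGeometry.AbelianSchemes

end
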